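import Summits.BirchSwinnertonDyer.BirchSwinnertonDyer.Theorems.TwoAdicConverseGoodTwists
import Summits.BirchSwinnertonDyer.BirchSwinnertonDyer.Theorems.TwoAdicConverseOrdLambdaHalfBridge
import HarnessLib

/-!
# Route `TwoAdicConverse` (rung S3): the head-line twist-family statements FROM THE NEW CHILDREN — PUBLISHED inputs
# (item 19167) ∧ the `λ`-half crux `OrdLambdaHalfAtTwo` (item 19556)

Cell `bsd-2adic` (run/shared/lean/pub/bsd-2adic/), seat `bsd-2adic-conv-1` (GEN 3). THEOREMS ONLY, bookkeeping after the re-split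
of item 19218 (route rev 8–15): seat GEN 0's head-line theorems of `Theorems/TwoAdicConverseGoodTwists.lean` (p418425) were stated
from the crux `GoodOrdinaryRankZeroTwoConverse` and, in `…_of_eisensteinHalf` form, from the OLD children (PUB ∧ the Eisenstein half
19272, now ASIDE). Here the same statements from the NEW children ON THE ROUTE DECLS: `Theses.TwoAdicConverse.OrdConversePublishedInputsAtTwo`
(19167) ∧ `Theses.TwoAdicConverse.OrdLambdaHalfAtTwo` (19556) — through the CLOSED glue
(`TwoAdicTwistConverse.goodOrdinaryRankZeroTwoConverse_of_ordLambdaHalfAtTwo`, p427789; glue item 19557 closed by p438938):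
* `goodOrdinaryRankZeroTwoConverse_of_lambdaHalf_route` — 19167 ∧ 19556 ⟹ 19218 (route decls throughout);
* `tendsto_familyProportion_rankZero_of_lambdaHalf` — for every non-CM `W` good ordinary at `2`: EXACTLY `1/2` of
  `d ∈ 𝓕 = {d square-free, d ≡ 1 (mod 4)}` have `ord_{s=1} L(W^{(d)},s) = rank W^{(d)}(ℚ) = 0 ∧ Ш(W^{(d)})` finite (the even half of
  Goldfeld WITH BSD-rank in `𝓕`), modulo 19167 ∧ 19556 + GZK, modularity, Monsky, Smith 2025 Thm. 1.1 for `W`;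
* `tendsto_familyProportion_rankZero_of_rootNumber_of_lambdaHalf` — for `100 %` of `d ∈ 𝓕`: `w(W^{(d)}) = +1 ⟹` the same.
So the S3 «a.e.-twist» rank statement of the director's row rests, after the re-split, on ONE open object: Kato's main conjecture
at `p = 2` AS PRINTED (`𝔭 ∌ 2`) for non-CM curves good ordinary at `2` (= item 19556, `Theorems/TwoAdicConverseKatoAwayFromTwoDefs.lean`).
Nothing asserted; 19556 stays OPEN; BSD is not proved by any of this. PARTITION (D-0054): none — RANK axis (S3); companion
formula cell X5@2 good-ord (B1·O1; 611 classes), owner bsd-2adic.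
-/

set_option linter.dupNamespace false
set_option autoImplicit false

noncomputable section

open scoped Classical
open Filter Topology WeierstrassCurve Literature.NumberTheory.EllipticCurves
  Literature.NumberTheory.EllipticCurves.ModularForms Literature.NumberTheory.EllipticCurves.Rank1Residual
  Summit.BirchSwinnertonDyer.BirchSwinnertonDyer.Theorems.GoldfeldGoodTwists

namespace Summit.BirchSwinnertonDyer.BirchSwinnertonDyer.Theorems.TwoAdicGoodTwists

open Summit.BirchSwinnertonDyer.BirchSwinnertonDyer.Theses.TwoAdicConverse

/-- **19167 ∧ 19556 ⟹ 19218, on the route decls** (the closed glue item 19557's content, by p427789's bridge; definitional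
unfolding of the inlined route statements). [cite: GreenbergLNM1716, Thm. 4.1 (p. 102)] [cite: Kato2004Asterisque, Thm. 17.4 (1)(2) (p. 273)] -/
theorem goodOrdinaryRankZeroTwoConverse_of_lambdaHalf_route
    (hP : Summit.BirchSwinnertonDyer.BirchSwinnertonDyer.Theses.TwoAdicConverse.OrdConversePublishedInputsAtTwo)
    (hL : Summit.BirchSwinnertonDyer.BirchSwinnertonDyer.Theses.TwoAdicConverse.OrdLambdaHalfAtTwo) :
    Summit.BirchSwinnertonDyer.BirchSwinnertonDyer.Theses.TwoAdicConverse.GoodOrdinaryRankZeroTwoConverse :=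
  TwoAdicTwistConverse.goodOrdinaryRankZeroTwoConverse_of_ordLambdaHalfAtTwo hP hL

variable (W : WeierstrassCurve ℚ) [W.IsElliptic] [W.IsGloballyMinimal]

/-- **The even half of Goldfeld with BSD in `𝓕`, from the NEW children (19167 ∧ 19556).** As GEN 0's
`tendsto_familyProportion_rankZero_of_monsky`, with the crux replaced by PUBLISHED inputs (`hP`, item 19167) and the `λ`-half
of the `2`-adic main conjecture on the class (`hL`, item 19556 = Kato's printed `p = 2` conjecture ∀ non-CM good-ordinary `E`, OPEN):
for every non-CM `W` good ordinary at `2`, exactly `1/2` of `d ∈ 𝓕` have `ord L(W^{(d)}) = rank = 0 ∧ Ш` finite — modulo GZK,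
modularity (`hmod`), Monsky's `2`-parity (`hMon`), Smith 2025 Thm. 1.1 for `W` (`hS`). [cite: arXiv250317619, Thm. 1.1 and Cor. 1.2]
[cite: GreenbergLNM1716, Thm. 4.1 (p. 102)] [cite: Kato2004Asterisque, Conj. 17.6 (p. 275)] -/
theorem tendsto_familyProportion_rankZero_of_lambdaHalf
    (hP : Summit.BirchSwinnertonDyer.BirchSwinnertonDyer.Theses.TwoAdicConverse.OrdConversePublishedInputsAtTwo)
    (hL : Summit.BirchSwinnertonDyer.BirchSwinnertonDyer.Theses.TwoAdicConverse.OrdLambdaHalfAtTwo)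
    (hGZK : rank_eq_analyticRank_of_analyticRank_le_one)
    (hmod : exists_isNewformOf) (hMon : monsky_selmerCorank_two_mod_two_eq)
    (hCM : ¬ W.HasCM) (hgo : GoodOrd W 2) (hS : smith_selmerCorank_density W) :
    Tendsto (fun X : ℕ ↦ (Nat.card {d : ℤ | Squarefree d ∧ |d| ≤ (X : ℤ) ∧ (d % 4 = 1 ∧
        ((W.quadraticTwist d).analyticRank = 0 ∧ (W.quadraticTwist d).mordellWeilRank = 0 ∧
          Finite (W.quadraticTwist d).sha))} : ℝ) /
      Nat.card {d : ℤ | Squarefree d ∧ |d| ≤ (X : ℤ) ∧ d % 4 = 1}) atTop (𝓝 (1 / 2)) :=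
  tendsto_familyProportion_rankZero_of_monsky W (goodOrdinaryRankZeroTwoConverse_of_lambdaHalf_route hP hL)
    hGZK hmod hMon hCM hgo hS

/-- **For `100 %` of `d ∈ 𝓕`: `w(W^{(d)}) = +1 ⟹ ord L = rank = 0 ∧ Ш` finite — from the NEW children (19167 ∧ 19556)**, GZK,
modularity, Monsky, Smith. [cite: arXiv250317619, Thm. 1.1 and Cor. 1.3] [cite: GreenbergLNM1716, Thm. 4.1 (p. 102)]
[cite: Kato2004Asterisque, Conj. 17.6 (p. 275)] -/
theorem tendsto_familyProportion_rankZero_of_rootNumber_of_lambdaHalf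
    (hP : Summit.BirchSwinnertonDyer.BirchSwinnertonDyer.Theses.TwoAdicConverse.OrdConversePublishedInputsAtTwo)
    (hL : Summit.BirchSwinnertonDyer.BirchSwinnertonDyer.Theses.TwoAdicConverse.OrdLambdaHalfAtTwo)
    (hGZK : rank_eq_analyticRank_of_analyticRank_le_one)
    (hmod : exists_isNewformOf) (hMon : monsky_selmerCorank_two_mod_two_eq)
    (hCM : ¬ W.HasCM) (hgo : GoodOrd W 2) (hS : smith_selmerCorank_density W) :
    Tendsto (fun X : ℕ ↦ (Nat.card {d : ℤ | Squarefree d ∧ |d| ≤ (X : ℤ) ∧ (d % 4 = 1 ∧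
        ((W.quadraticTwist d).rootNumber = 1 →
          ((W.quadraticTwist d).analyticRank = 0 ∧ (W.quadraticTwist d).mordellWeilRank = 0 ∧
            Finite (W.quadraticTwist d).sha)))} : ℝ) /
      Nat.card {d : ℤ | Squarefree d ∧ |d| ≤ (X : ℤ) ∧ d % 4 = 1}) atTop (𝓝 1) :=
  tendsto_familyProportion_rankZero_of_rootNumber W (goodOrdinaryRankZeroTwoConverse_of_lambdaHalf_route hP hL) hGZK
    (fun E _ ↦ p_parity_of_selmerCorank_mod_two_eq_of_exists_isNewformOf E 2 hmod (hMon.apply E)) hCM hgo hS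

end Summit.BirchSwinnertonDyer.BirchSwinnertonDyer.Theorems.TwoAdicGoodTwists

end
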